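import Summits.PneNP.PneNP.Theses.KarlinRubin
import Summits.PneNP.PneNP.Theorems.KarlinRubinMonotoneBlindDnfPlanted
import Literature.Probability.Moments.DisjointCoordinates

/-!
# Route KarlinRubin, crux `MonotoneBlind` (stmt-PneNP-18027), line `Sketch`: stub `stub_orDisjoint`

The toy ACCUMULATION lemma of the hinge framework of line `Sketch`. For a test `f : EdgeVec n → Bool` and
a planted set `A` the dead–revival mass at `A` is `adv_A(f) := Pr_x[f x = false ∧ f (plant A x) = true]`
(`x ∼ G(n,1/2)`, i.e. uniform on `EdgeVec n`). For an `∨` of two children `g`, `h` determined by DISJOINT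
slot sets `S`, `T`:

  `adv_A(g ∨ h) ≤ adv_A(g) · Pr[h dead] + adv_A(h) · Pr[g dead]`.

Proof: the `∨` is dead iff both children are dead and is revived iff one child is revived, so the event
is contained in `({g dead ∧ g revived} ∩ {h dead}) ∪ ({h dead ∧ h revived} ∩ {g dead})`; union bound;
and in each intersection the first event is determined by the slots of one child (planting acts slot by
slot, `plant_apply_eq_true_iff`, so `x ↦ g (plant A x)` is again `S`-determined) and the second by the
slots of the other child, hence the two are independent under the uniform measure: the counting product
rule `Literature.Probability.Moments.card_filter_and_mul_eq` divided by `#(EdgeVec n) = 2^{C(n,2)}`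
(`erdosRenyiHalf_toOuterMeasure_eq_card_div`).

All `--supports stmt-PneNP-18027`; no definitions.
-/

set_option linter.dupNamespace false -- `Summit.PneNP.PneNP.…` is the layout-mandated namespace

namespace Summit.PneNP.PneNP.Theorems.MonotoneBlind.VertexCover

open Literature.Computability.Complexity Literature.Probability.RandomGraphs.PlantedClique Filter Finset
open scoped ENNReal Topology Classical

variable {n : ℕ}

/-! ### Planting acts slot by slot -/

/-- If two noises agree on the slots of `S`, so do their plantings: `plant A x e` depends only on `x e`
and on whether `e` lies inside `A`. [folklore] -/
theorem plant_congr_on (A : Finset (Fin n)) (S : Finset (⊤ : SimpleGraph (Fin n)).edgeSet)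
    {x x' : EdgeVec n} (hxx' : ∀ e ∈ S, x e = x' e) : ∀ e ∈ S, plant A x e = plant A x' e := by
  intro e he
  rw [Bool.eq_iff_iff, plant_apply_eq_true_iff, plant_apply_eq_true_iff, hxx' e he]

/-- A test determined by the slots of `S` is still `S`-determined after planting. [folklore] -/
theorem apply_plant_congr_on (A : Finset (Fin n)) (S : Finset (⊤ : SimpleGraph (Fin n)).edgeSet)
    (g : EdgeVec n → Bool) (hg : ∀ x x' : EdgeVec n, (∀ e ∈ S, x e = x' e) → g x = g x')
    {x x' : EdgeVec n} (hxx' : ∀ e ∈ S, x e = x' e) : g (plant A x) = g (plant A x') :=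
  hg _ _ (plant_congr_on A S hxx')

/-! ### Independence of disjointly determined events under `G(n,1/2)` -/

/-- `#(EdgeVec n) = 2^{#slots}`. [folklore] -/
theorem card_edgeVec_eq_two_pow :
    Fintype.card (EdgeVec n) = 2 ^ Fintype.card (⊤ : SimpleGraph (Fin n)).edgeSet := by
  rw [Fintype.card_fun, Fintype.card_bool]

/-- The counting product rule for events of the edge vector: if `P` is determined by the slots of `S`,
`Q` by the slots of `T`, and `S ∩ T = ∅`, then `#{P ∧ Q} · #(EdgeVec n) = #{P} · #{Q}`
(`Literature.Probability.Moments.card_filter_and_mul_eq`). [folklore] -/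
theorem card_filter_and_mul_card_edgeVec {S T : Finset (⊤ : SimpleGraph (Fin n)).edgeSet}
    (hST : Disjoint S T) (P Q : EdgeVec n → Prop)
    (hP : ∀ x x' : EdgeVec n, (∀ e ∈ S, x e = x' e) → (P x ↔ P x'))
    (hQ : ∀ x x' : EdgeVec n, (∀ e ∈ T, x e = x' e) → (Q x ↔ Q x')) :
    #(univ.filter fun x : EdgeVec n => P x ∧ Q x) * Fintype.card (EdgeVec n) =
      #(univ.filter fun x : EdgeVec n => P x) * #(univ.filter fun x : EdgeVec n => Q x) := by
  have h := Literature.Probability.Moments.card_filter_and_mul_eq hST P Q hP hQ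
  rw [card_edgeVec_eq_two_pow]
  exact_mod_cast h

/-- `a · N = b · c` gives `a / N = (b / N) · (c / N)` in `ℝ≥0∞` for a finite nonzero `N`. [folklore] -/
theorem div_eq_div_mul_div_of_mul_eq {a b c N : ℝ≥0∞} (hN0 : N ≠ 0) (hNtop : N ≠ ⊤)
    (h : a * N = b * c) : a / N = b / N * (c / N) := by
  rw [div_eq_mul_inv, div_eq_mul_inv, div_eq_mul_inv]
  calc a * N⁻¹ = a * (N * N⁻¹) * N⁻¹ := by rw [ENNReal.mul_inv_cancel hN0 hNtop, mul_one]
    _ = b * c * N⁻¹ * N⁻¹ := by rw [← mul_assoc, h]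
    _ = b * N⁻¹ * (c * N⁻¹) := by ring

/-- **Independence of disjointly determined events under `G(n,1/2)`.** If the event `P` is determined by
the slots of `S`, `Q` by the slots of `T`, and `S ∩ T = ∅`, then `Pr[P ∧ Q] = Pr[P] · Pr[Q]` for the
uniform edge vector (product probability space). [folklore] -/
theorem erdosRenyiHalf_and_eq_mul_of_disjoint {S T : Finset (⊤ : SimpleGraph (Fin n)).edgeSet}
    (hST : Disjoint S T) (P Q : EdgeVec n → Prop)
    (hP : ∀ x x' : EdgeVec n, (∀ e ∈ S, x e = x' e) → (P x ↔ P x'))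
    (hQ : ∀ x x' : EdgeVec n, (∀ e ∈ T, x e = x' e) → (Q x ↔ Q x')) :
    (erdosRenyiHalf n).toOuterMeasure {x | P x ∧ Q x} =
      (erdosRenyiHalf n).toOuterMeasure {x | P x} * (erdosRenyiHalf n).toOuterMeasure {x | Q x} := by
  have hcount : (#(univ.filter fun x : EdgeVec n => x ∈ {x : EdgeVec n | P x ∧ Q x}) : ℝ≥0∞) *
      (Fintype.card (EdgeVec n) : ℝ≥0∞) =
      (#(univ.filter fun x : EdgeVec n => x ∈ {x : EdgeVec n | P x}) : ℝ≥0∞) *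
        (#(univ.filter fun x : EdgeVec n => x ∈ {x : EdgeVec n | Q x}) : ℝ≥0∞) := by
    have h := card_filter_and_mul_card_edgeVec hST P Q hP hQ
    simp only [Set.mem_setOf_eq]
    exact_mod_cast h
  rw [erdosRenyiHalf_toOuterMeasure_eq_card_div, erdosRenyiHalf_toOuterMeasure_eq_card_div,
    erdosRenyiHalf_toOuterMeasure_eq_card_div]
  exact div_eq_div_mul_div_of_mul_eq (by exact_mod_cast Fintype.card_ne_zero) (ENNReal.natCast_ne_top _)
    hcount

/-! ### The stub -/

/-- **stub_orDisjoint** (S–M; toy ACCUMULATION lemma — an `∨` of children with DISJOINT supports; stub of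
line `Sketch` of crux stmt-PneNP-18027). For tests `g, h` determined by disjoint slot sets `S, T` and any
planted set `A`: the dead–revival mass of `g || h` at `A` is
`≤ adv_A(g) · Pr[h dead] + adv_A(h) · Pr[g dead]` (`adv_A(f) := Pr_x[f x = false ∧ f (plant A x) = true]`):
revival of the `∨` revives a child while the other is dead (containment and union bound), and events
determined by disjoint coordinate sets are independent under `G(n,1/2)`
(`erdosRenyiHalf_and_eq_mul_of_disjoint`). [folklore] -/
theorem stub_orDisjoint :
    ∀ (n : ℕ) (A : Finset (Fin n)) (S T : Finset ((⊤ : SimpleGraph (Fin n)).edgeSet)), Disjoint S T →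
      ∀ g h : EdgeVec n → Bool,
      (∀ x x' : EdgeVec n, (∀ e ∈ S, x e = x' e) → g x = g x') →
      (∀ x x' : EdgeVec n, (∀ e ∈ T, x e = x' e) → h x = h x') →
      (erdosRenyiHalf n).toOuterMeasure
          {x | (g x || h x) = false ∧ (g (plant A x) || h (plant A x)) = true} ≤
        (erdosRenyiHalf n).toOuterMeasure {x | g x = false ∧ g (plant A x) = true} *
            (erdosRenyiHalf n).toOuterMeasure {x | h x = false} +
          (erdosRenyiHalf n).toOuterMeasure {x | h x = false ∧ h (plant A x) = true} *
            (erdosRenyiHalf n).toOuterMeasure {x | g x = false} := by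
  intro n A S T hST g h hg hh
  -- containment: the `∨` is dead iff both children are dead, revived iff one child is revived
  have hsub : {x : EdgeVec n | (g x || h x) = false ∧ (g (plant A x) || h (plant A x)) = true} ⊆
      {x | (g x = false ∧ g (plant A x) = true) ∧ h x = false} ∪
        {x | (h x = false ∧ h (plant A x) = true) ∧ g x = false} := by
    intro x hx
    simp only [Set.mem_setOf_eq, Bool.or_eq_false_iff, Bool.or_eq_true] at hx
    obtain ⟨⟨hgx, hhx⟩, hgp | hhp⟩ := hx
    · exact Or.inl ⟨⟨hgx, hgp⟩, hhx⟩
    · exact Or.inr ⟨⟨hhx, hhp⟩, hgx⟩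
  -- independence: `{g dead ∧ g revived}` is `S`-determined, `{h dead}` is `T`-determined (and symmetrically)
  have h1 : (erdosRenyiHalf n).toOuterMeasure {x | (g x = false ∧ g (plant A x) = true) ∧ h x = false} =
      (erdosRenyiHalf n).toOuterMeasure {x | g x = false ∧ g (plant A x) = true} *
        (erdosRenyiHalf n).toOuterMeasure {x | h x = false} :=
    erdosRenyiHalf_and_eq_mul_of_disjoint hST (fun x => g x = false ∧ g (plant A x) = true)
      (fun x => h x = false)
      (fun x x' hxx' => by rw [hg x x' hxx', apply_plant_congr_on A S g hg hxx'])
      (fun x x' hxx' => by rw [hh x x' hxx'])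
  have h2 : (erdosRenyiHalf n).toOuterMeasure {x | (h x = false ∧ h (plant A x) = true) ∧ g x = false} =
      (erdosRenyiHalf n).toOuterMeasure {x | h x = false ∧ h (plant A x) = true} *
        (erdosRenyiHalf n).toOuterMeasure {x | g x = false} :=
    erdosRenyiHalf_and_eq_mul_of_disjoint hST.symm (fun x => h x = false ∧ h (plant A x) = true)
      (fun x => g x = false)
      (fun x x' hxx' => by rw [hh x x' hxx', apply_plant_congr_on A T h hh hxx'])
      (fun x x' hxx' => by rw [hg x x' hxx'])
  calc (erdosRenyiHalf n).toOuterMeasure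
        {x | (g x || h x) = false ∧ (g (plant A x) || h (plant A x)) = true}
      ≤ (erdosRenyiHalf n).toOuterMeasure
          ({x | (g x = false ∧ g (plant A x) = true) ∧ h x = false} ∪
            {x | (h x = false ∧ h (plant A x) = true) ∧ g x = false}) :=
        MeasureTheory.measure_mono hsub
    _ ≤ (erdosRenyiHalf n).toOuterMeasure {x | (g x = false ∧ g (plant A x) = true) ∧ h x = false} +
          (erdosRenyiHalf n).toOuterMeasure {x | (h x = false ∧ h (plant A x) = true) ∧ g x = false} :=
        MeasureTheory.measure_union_le _ _
    _ = _ := by rw [h1, h2]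

end Summit.PneNP.PneNP.Theorems.MonotoneBlind.VertexCover
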